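import Summits.Ventures.CertifiedManyBodySolver.Upper.BernoulliProductMixture
import Literature.MathematicalPhysics.QuantumLattice.HubbardTorusPlaquetteDressedBound
import Literature.MathematicalPhysics.QuantumLattice.HubbardBoxSectorEnergyBounds
import Literature.MathematicalPhysics.QuantumLattice.HubbardNNNHoppingRectSymmetries
import Literature.MathematicalPhysics.QuantumLattice.HubbardRectangularTorus
import HarnessLib

/-!
# Ventures/CertifiedManyBodySolver — Upper/BlochDressedMixture.lean

HONEST FRAMING: first certified bounds; not a superconductivity verdict; every number certified or labelled float.

THE PRODUCT-BERNOULLI MIXTURE STEP FOR SLATER-FUNCTIONAL UPPER BOUNDS (sr-mbsolver L3 engine seat E1; step D1+D2 assembly of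
the Lean route for the plaquette-dressed translation-invariant quasi-free uppers, eng-1/LEAN-GLUE-QF.md §4; theorem-only, no
certificate value appears, nothing is claimed). Setting of `HartreeFockBlochMixture`: square torus `(ℤ/L)²` with `L ≥ 3` EVEN, a
magnetic cell (`k i · M i = L`), blocks `Q σ κ` Hermitian with spectra in `[0,1]`, mean filling `n̄ = re Σ tr Q σ κ / L² ∈ (0,2)`,
`U ≥ 0`.
* `line_le_groundEnergyAt_div` — for a supporting line `s` of the convex `e(t,U;·)` at `n̄` and EVERY `N ≤ 2L²`:
  `e(n̄) + s (N/L² − n̄) ≤ E_{(ℤ/L)²}(N)/L² + 16|t|/L` (sectors `N < 2L²` by the tiling bound `energyDensity2D_le_of_lt`; the filled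
  sector by particle–hole symmetry `E(2L²) = U L²` and `supporting_line_at_two_le`);
* `isHermitian_spinBlock_blochMatrix`, `spinBlock_blochMatrix_mul_self`, `trace_spinBlock_blochMatrix` — the torus one-body matrix
  of a Bloch family of Hermitian idempotents is an orthogonal projection with trace `Σ tr`;
* **`energyDensity2D_le_avg_of_slaterBound`** — for ANY real functional `D` of one-body matrices that bounds the torus ground
  energy on orthogonal projections (`P = Pᴴ = P²`, `tr P = N` ⇒ `E(N) ≤ D P`):
  `e(n̄) ≤ (Σ_E W(E) · D(P_E)) / L² + 16|t|/L`, the sum over all product-Bernoulli patterns `E` with members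
  `P_E = spinBlock (σ ↦ blochMatrix (κ ↦ bernoulliProj (Q σ κ) (E (σ,κ))))` and weights `W(E) = Π w` (Jensen along the supporting
  line absorbs the members' integer fillings; `Σ_E W(E) N_E = n̄ L²` by `sum_prodWeight_mul_sum_card`);
* **`energyDensity2D_le_avg_dressed`** — the instance `D = re` (plaquette-dressed Slater functional of
  `PlaquetteLUC.groundEnergyAt_le_dressed`) for one layer of number-conserving plaquette unitaries `u_c` on the torus `(ℤ/2m)²`.
The decorrelation file `Upper/BlochDecorrelation.lean` replaces the average over members by the functional at
`P_Q = spinBlock (σ ↦ blochMatrix Q_σ)` up to `O(1/|k|)`; the two are combined in `Upper/BlochDressedBound.lean`. This file does not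
import the decorrelation file (only `Upper/BernoulliProductMixture.lean`). Sources: Lieb 1981 (variational principle) [Lieb1981];
Bach–Lieb–Solovej 1994 (2c.36), Thm 2.3 [BachLiebSolovej1994]; Lieb 1989 (particle–hole) [LiebPRL1989]. Everything proved; no definition.
-/

noncomputable section

namespace Summit.Ventures.CertifiedManyBodySolver.Upper

open Matrix Finset
open Literature.MathematicalPhysics.QuantumLattice Literature.MathematicalPhysics.QuantumLattice.HartreeFock
  Literature.MathematicalPhysics.QuantumLattice.ThermodynamicLimit HubbardWave0
open scoped ComplexOrder ComplexConjugate

/-! ### §1. One line below every sector energy -/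

/-- **A supporting line of `e` lies below every sector energy of the torus (up to the tiling error).** For `U ≥ 0`, `L ≥ 1` even,
a supporting line `x ↦ e(n̄) + s(x − n̄)` of the convex energy density on `[0,2)`, and every particle number `N ≤ 2L²`:
`e(n̄) + s(N/L² − n̄) ≤ E_{(ℤ/L)²}(t,U;N)/L² + 16|t|/L`. Sectors `N < 2L²`: the tiling bound; the filled sector: `E(2L²) = U L²`
(particle–hole symmetry of the even torus, `E(0) = 0`) and `e(n̄) + s(2 − n̄) ≤ U`. [folklore] -/
theorem line_le_groundEnergyAt_div {L : ℕ} (hL1 : 1 ≤ L) (hLe : Even L) (t : ℝ) {U : ℝ} (hU : 0 ≤ U) {ρ s : ℝ}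
    (hs : ∀ x ∈ Set.Ico (0 : ℝ) 2, energyDensity2D t U ρ + s * (x - ρ) ≤ energyDensity2D t U x) {N : ℕ} (hN : N ≤ 2 * (L * L)) :
    energyDensity2D t U ρ + s * ((N : ℝ) / (L : ℝ) ^ 2 - ρ) ≤
      groundEnergyAt (fermionTorusGraph 2 L) t U N / (L : ℝ) ^ 2 + 16 * |t| / L := by
  have hL0 : (0 : ℝ) < L := by exact_mod_cast hL1
  have hL2 : (0 : ℝ) < (L : ℝ) ^ 2 := by positivity
  rw [groundEnergyAt_fermionTorusGraph_two]
  rcases Nat.lt_or_ge N (2 * (L * L)) with hlt | hge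
  · have hNr : (N : ℝ) / (L : ℝ) ^ 2 ∈ Set.Ico (0 : ℝ) 2 := by
      refine ⟨by positivity, ?_⟩
      rw [div_lt_iff₀ hL2]
      have h' : ((N : ℕ) : ℝ) < ((2 * (L * L) : ℕ) : ℝ) := Nat.cast_lt.mpr hlt
      push_cast at h'
      nlinarith
    exact (hs _ hNr).trans (energyDensity2D_le_of_lt t hU hL1 hlt)
  · have hNeq : N = 2 * (L * L) := le_antisymm hN hge
    subst hNeq
    have hph := groundEnergyAt_fermionRectTorus_particleHole hLe hLe t U (N := 2 * (L * L)) le_rfl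
    rw [Nat.sub_self, groundEnergyAt_zero_eq] at hph
    have hfull : groundEnergyAt (fermionRectTorusGraph L L) t U (2 * (L * L)) = U * (L : ℝ) ^ 2 := by
      rw [hph]; push_cast; ring
    have htwo : (((2 * (L * L) : ℕ) : ℝ) / (L : ℝ) ^ 2) = 2 := by
      push_cast; field_simp
    rw [htwo, hfull, mul_div_assoc, div_self hL2.ne', mul_one]
    have h5 := supporting_line_at_two_le t hU hs
    have h6 : 0 ≤ 16 * |t| / (L : ℝ) := by positivity
    linarith

/-! ### §2. Bloch families of Hermitian idempotents give orthogonal projections on the torus -/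

section Projection

variable {d L : ℕ} [NeZero L] {k M : Fin d → ℕ} [∀ i, NeZero (k i)] [∀ i, NeZero (M i)]

omit [NeZero L] in
/-- The collinear torus one-body matrix of a Bloch family of Hermitian blocks is Hermitian. [cite: BachLiebSolovej1994, eq. (3a.2)] -/
theorem isHermitian_spinBlock_blochMatrix (hkM : ∀ i, k i * M i = L)
    (X : Fin 2 → RectTorusSite k → Matrix (RectTorusSite M) (RectTorusSite M) ℂ) (hX : ∀ σ κ, (X σ κ).IsHermitian) :
    (spinBlock fun σ => blochMatrix hkM (X σ)).IsHermitian := by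
  rw [Matrix.IsHermitian, conjTranspose_spinBlock]
  congr 1
  funext σ
  rw [conjTranspose_blochMatrix]
  congr 1
  funext κ
  exact (hX σ κ).eq

/-- … and idempotent when the blocks are. [cite: BachLiebSolovej1994, eq. (3a.2)] -/
theorem spinBlock_blochMatrix_mul_self (hkM : ∀ i, k i * M i = L)
    (X : Fin 2 → RectTorusSite k → Matrix (RectTorusSite M) (RectTorusSite M) ℂ) (hX2 : ∀ σ κ, X σ κ * X σ κ = X σ κ) :
    (spinBlock fun σ => blochMatrix hkM (X σ)) * (spinBlock fun σ => blochMatrix hkM (X σ)) =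
      spinBlock fun σ => blochMatrix hkM (X σ) := by
  rw [spinBlock_mul_spinBlock]
  congr 1
  funext σ
  rw [blochMatrix_mul]
  congr 1
  funext κ
  exact hX2 σ κ

/-- … with trace the total trace of the blocks. [cite: BachLiebSolovej1994, eq. (3a.2)] -/
theorem trace_spinBlock_blochMatrix (hkM : ∀ i, k i * M i = L)
    (X : Fin 2 → RectTorusSite k → Matrix (RectTorusSite M) (RectTorusSite M) ℂ) :
    (spinBlock fun σ => blochMatrix hkM (X σ)).trace = ∑ σ, ∑ κ, (X σ κ).trace := by
  rw [trace_spinBlock]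
  simp_rw [trace_blochMatrix]

end Projection

/-! ### §3. The mixture step for an arbitrary Slater functional bound -/

section Mixture

variable {L : ℕ} [NeZero L] {k M : Fin 2 → ℕ} [∀ i, NeZero (k i)] [∀ i, NeZero (M i)]

/-- **Lieb's variational principle, mixture form, for an arbitrary Slater functional bound.** On the even torus `(ℤ/L)²`, `L ≥ 3`,
with a magnetic cell `k i · M i = L`: let `D` be a real functional of one-body matrices with `E(N) ≤ D P` for every orthogonal
projection `P` of trace `N`. Then for blocks `Q σ κ` with spectra in `[0,1]` and mean filling `n̄ ∈ (0,2)`,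
`e(t,U;n̄) ≤ (Σ_E W(E) D(P_E))/L² + 16|t|/L`, the product-Bernoulli average over the Slater members `P_E`. [cite: Lieb1981, eq. (4)] -/
theorem energyDensity2D_le_avg_of_slaterBound (hkM : ∀ i, k i * M i = L) (hL : 3 ≤ L) (hLe : Even L) (t : ℝ) {U : ℝ} (hU : 0 ≤ U)
    (Q : Fin 2 → RectTorusSite k → Matrix (RectTorusSite M) (RectTorusSite M) ℂ) (hQh : ∀ σ κ, (Q σ κ).IsHermitian)
    (h0 : ∀ σ κ i, 0 ≤ (hQh σ κ).eigenvalues i) (h1 : ∀ σ κ i, (hQh σ κ).eigenvalues i ≤ 1)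
    (hn0 : 0 < (∑ σ, ∑ κ, (Q σ κ).trace).re / (L : ℝ) ^ 2) (hn2 : (∑ σ, ∑ κ, (Q σ κ).trace).re / (L : ℝ) ^ 2 < 2)
    (D : Matrix (Orb (FermionTorus 2 L)) (Orb (FermionTorus 2 L)) ℂ → ℝ)
    (hD : ∀ (P : Matrix (Orb (FermionTorus 2 L)) (Orb (FermionTorus 2 L)) ℂ), P.IsHermitian → P * P = P →
      ∀ N : ℕ, P.trace = N → groundEnergyAt (fermionTorusGraph 2 L) t U N ≤ D P) :
    energyDensity2D t U ((∑ σ, ∑ κ, (Q σ κ).trace).re / (L : ℝ) ^ 2) ≤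
      (∑ E : Fin 2 × RectTorusSite k → RectTorusSite M → Bool,
          (∏ b : Fin 2 × RectTorusSite k, bernoulliWeight (hQh b.1 b.2) (E b)) *
            D (spinBlock fun σ => blochMatrix hkM fun κ => bernoulliProj (hQh σ κ) (E (σ, κ)))) / (L : ℝ) ^ 2 +
        16 * |t| / L := by
  classical
  set nbar := (∑ σ, ∑ κ, (Q σ κ).trace).re / (L : ℝ) ^ 2 with hnbar
  have hL0 : (0 : ℝ) < L := by exact_mod_cast (show 0 < L by omega)
  have hL2 : (0 : ℝ) < (L : ℝ) ^ 2 := by positivity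
  obtain ⟨s, hs⟩ := exists_supporting_line_energyDensity2D t hU hn0 hn2
  -- abbreviations: weights, member families, member particle numbers
  obtain ⟨W, hW⟩ : ∃ W : (Fin 2 × RectTorusSite k → RectTorusSite M → Bool) → ℝ,
      W = fun E => ∏ b : Fin 2 × RectTorusSite k, bernoulliWeight (hQh b.1 b.2) (E b) := ⟨_, rfl⟩
  obtain ⟨cnt, hcnt⟩ : ∃ cnt : (Fin 2 × RectTorusSite k → RectTorusSite M → Bool) → ℕ,
      cnt = fun E => ∑ b : Fin 2 × RectTorusSite k, (Finset.univ.filter fun i => E b i = true).card := ⟨_, rfl⟩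
  have hWE : ∀ E, (∏ b : Fin 2 × RectTorusSite k, bernoulliWeight (hQh b.1 b.2) (E b)) = W E := fun E => by rw [hW]
  simp_rw [hWE]
  have hW0 : ∀ E, 0 ≤ W E := fun E => by
    rw [hW]; exact prodWeight_nonneg (fun b : Fin 2 × RectTorusSite k => hQh b.1 b.2) (fun b i => h0 b.1 b.2 i) (fun b i => h1 b.1 b.2 i) E
  have hW1 : ∑ E, W E = 1 := by rw [hW]; exact sum_prodWeight (fun b : Fin 2 × RectTorusSite k => hQh b.1 b.2)
  have hWN : ∑ E, W E * (cnt E : ℝ) = nbar * (L : ℝ) ^ 2 := by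
    have h := sum_prodWeight_mul_sum_card (fun b : Fin 2 × RectTorusSite k => hQh b.1 b.2)
    have hc : ∀ E, (cnt E : ℝ) = ∑ b : Fin 2 × RectTorusSite k, ((Finset.univ.filter fun i => E b i = true).card : ℝ) := by
      intro E; rw [hcnt]; push_cast; rfl
    simp_rw [hc, hW]
    rw [h, hnbar, div_mul_cancel₀ _ hL2.ne', Complex.re_sum, Fintype.sum_prod_type]
    refine Finset.sum_congr rfl fun σ _ => ?_
    rw [Complex.re_sum]
    refine Finset.sum_congr rfl fun κ _ => ?_
    rw [(hQh σ κ).trace_eq_sum_eigenvalues]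
    norm_cast
  -- the member inequality
  have hmember : ∀ E : Fin 2 × RectTorusSite k → RectTorusSite M → Bool,
      energyDensity2D t U nbar + s * ((cnt E : ℝ) / (L : ℝ) ^ 2 - nbar) ≤
        D (spinBlock fun σ => blochMatrix hkM fun κ => bernoulliProj (hQh σ κ) (E (σ, κ))) / (L : ℝ) ^ 2 + 16 * |t| / L := by
    intro E
    have hPh := isHermitian_spinBlock_blochMatrix hkM (fun σ κ => bernoulliProj (hQh σ κ) (E (σ, κ)))
      (fun σ κ => isHermitian_bernoulliProj _ _)
    have hPP := spinBlock_blochMatrix_mul_self hkM (fun σ κ => bernoulliProj (hQh σ κ) (E (σ, κ)))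
      (fun σ κ => bernoulliProj_mul_self _ _)
    have htr : (spinBlock fun σ => blochMatrix hkM fun κ => bernoulliProj (hQh σ κ) (E (σ, κ))).trace = (cnt E : ℂ) := by
      rw [trace_spinBlock_blochMatrix hkM (fun σ κ => bernoulliProj (hQh σ κ) (E (σ, κ))), hcnt]
      push_cast
      rw [Fintype.sum_prod_type]
      exact Finset.sum_congr rfl fun σ _ => Finset.sum_congr rfl fun κ _ => trace_bernoulliProj _ _
    have hle : cnt E ≤ 2 * (L * L) := by
      have hb : ∀ b ∈ (Finset.univ : Finset (Fin 2 × RectTorusSite k)),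
          (Finset.univ.filter fun i => E b i = true).card ≤ Fintype.card (RectTorusSite M) :=
        fun b _ => (Finset.card_filter_le _ _).trans (by rw [Finset.card_univ])
      have h := Finset.sum_le_sum hb
      rw [Finset.sum_const, Finset.card_univ, smul_eq_mul, Fintype.card_prod, Fintype.card_fin] at h
      have hcard : Fintype.card (RectTorusSite k) * Fintype.card (RectTorusSite M) = L * L := by
        rw [HeisenbergTL.card_rectTorusSite_eq_prod, HeisenbergTL.card_rectTorusSite_eq_prod, ← Finset.prod_mul_distrib,
          Finset.prod_congr rfl fun i _ => hkM i, Finset.prod_const, Finset.card_univ, Fintype.card_fin, sq]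
      rw [hcnt]
      calc _ ≤ 2 * Fintype.card (RectTorusSite k) * Fintype.card (RectTorusSite M) := h
        _ = 2 * (L * L) := by rw [mul_assoc, hcard]
    have hline := line_le_groundEnergyAt_div (show 1 ≤ L by omega) hLe t hU hs hle
    have hDm := hD _ hPh hPP (cnt E) htr
    have h4 := div_le_div_of_nonneg_right hDm hL2.le
    linarith
  -- average the member inequalities with the weights
  have key : ∑ E, W E * (energyDensity2D t U nbar + s * ((cnt E : ℝ) / (L : ℝ) ^ 2 - nbar)) ≤
      ∑ E, W E * (D (spinBlock fun σ => blochMatrix hkM fun κ => bernoulliProj (hQh σ κ) (E (σ, κ))) / (L : ℝ) ^ 2 + 16 * |t| / L) :=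
    Finset.sum_le_sum fun E _ => mul_le_mul_of_nonneg_left (hmember E) (hW0 E)
  have eqL : ∑ E, W E * (energyDensity2D t U nbar + s * ((cnt E : ℝ) / (L : ℝ) ^ 2 - nbar)) = energyDensity2D t U nbar := by
    have hsplit : ∀ E, W E * (energyDensity2D t U nbar + s * ((cnt E : ℝ) / (L : ℝ) ^ 2 - nbar)) =
        W E * energyDensity2D t U nbar + (s / (L : ℝ) ^ 2) * (W E * (cnt E : ℝ)) - W E * (s * nbar) := fun E => by
      field_simp; ring
    rw [Finset.sum_congr rfl fun E _ => hsplit E, Finset.sum_sub_distrib, Finset.sum_add_distrib, ← Finset.sum_mul, hW1, one_mul,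
      ← Finset.mul_sum, hWN, ← Finset.sum_mul, hW1, one_mul]
    field_simp
    ring
  have eqR : ∑ E, W E * (D (spinBlock fun σ => blochMatrix hkM fun κ => bernoulliProj (hQh σ κ) (E (σ, κ))) / (L : ℝ) ^ 2 +
      16 * |t| / L) = (∑ E, W E * D (spinBlock fun σ => blochMatrix hkM fun κ => bernoulliProj (hQh σ κ) (E (σ, κ)))) / (L : ℝ) ^ 2 +
        16 * |t| / L := by
    have hsplit : ∀ E, W E * (D (spinBlock fun σ => blochMatrix hkM fun κ => bernoulliProj (hQh σ κ) (E (σ, κ))) / (L : ℝ) ^ 2 +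
        16 * |t| / L) = W E * D (spinBlock fun σ => blochMatrix hkM fun κ => bernoulliProj (hQh σ κ) (E (σ, κ))) / (L : ℝ) ^ 2 +
          W E * (16 * |t| / L) := fun E => by ring
    rw [Finset.sum_congr rfl fun E _ => hsplit E, Finset.sum_add_distrib, ← Finset.sum_mul, hW1, one_mul, Finset.sum_div]
  linarith [key, eqL, eqR]

end Mixture

/-! ### §4. The plaquette-dressed instance -/

section Dressed

open PlaquetteLUC

variable {m : ℕ} [NeZero m] {k M : Fin 2 → ℕ} [∀ i, NeZero (k i)] [∀ i, NeZero (M i)]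

/-- **The plaquette-dressed Slater bound, averaged over the product-Bernoulli members.** On the torus `(ℤ/2m)²` (`m ≥ 2`) tiled by
`m²` plaquettes, for every family of number-conserving plaquette unitaries `u_c` and blocks `Q σ κ` with spectra in `[0,1]`,
`n̄ ∈ (0,2)`, `U ≥ 0`: `e(t,U;n̄) ≤ (Σ_E W(E) · re 𝒟_u(P_E))/(2m)² + 16|t|/(2m)` with `𝒟_u` the dressed functional of
`PlaquetteLUC.groundEnergyAt_le_dressed` (sum over plaquettes of `⟨u_cᴴ H_plaq u_c⟩` in the window reduced density matrix plus the
link terms). [cite: BachLiebSolovej1994, eq. (2c.36)] -/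
theorem energyDensity2D_le_avg_dressed (hm : 2 ≤ m) (hkM : ∀ i, k i * M i = m * 2) (t : ℝ) {U : ℝ} (hU : 0 ≤ U)
    (Q : Fin 2 → RectTorusSite k → Matrix (RectTorusSite M) (RectTorusSite M) ℂ) (hQh : ∀ σ κ, (Q σ κ).IsHermitian)
    (h0 : ∀ σ κ i, 0 ≤ (hQh σ κ).eigenvalues i) (h1 : ∀ σ κ i, (hQh σ κ).eigenvalues i ≤ 1)
    (hn0 : 0 < (∑ σ, ∑ κ, (Q σ κ).trace).re / ((m * 2 : ℕ) : ℝ) ^ 2)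
    (hn2 : (∑ σ, ∑ κ, (Q σ κ).trace).re / ((m * 2 : ℕ) : ℝ) ^ 2 < 2)
    (u : (Fin 2 → Fin m) → Matrix (Finset (Orb (FermionTorus 2 2))) (Finset (Orb (FermionTorus 2 2))) ℂ)
    (hu : ∀ c, (u c)ᴴ * u c = 1) (huN : ∀ c, Commute totalNumberOp (u c)) :
    energyDensity2D t U ((∑ σ, ∑ κ, (Q σ κ).trace).re / ((m * 2 : ℕ) : ℝ) ^ 2) ≤
      (∑ E : Fin 2 × RectTorusSite k → RectTorusSite M → Bool,
          (∏ b : Fin 2 × RectTorusSite k, bernoulliWeight (hQh b.1 b.2) (E b)) *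
          ((∑ c : Fin 2 → Fin m, ∑ s : Finset (Orb (FermionTorus 2 2)), ∑ s' : Finset (Orb (FermionTorus 2 2)),
              ((u c)ᴴ * hamiltonian plaquetteGraph t U * u c) s s' *
                slaterRDM ((spinBlock fun σ => blochMatrix hkM fun κ => bernoulliProj (hQh σ κ) (E (σ, κ))).submatrix
                  (fun a => orb (cellEmb c (ofLex a).1) (ofLex a).2) (fun a => orb (cellEmb c (ofLex a).1) (ofLex a).2)) s s') +
            ∑ ℓ : (Fin 2 → Fin m) × Fin 2, ∑ s : Finset (Orb (Fin 2 ×ₗ FermionTorus 2 2)),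
              ∑ s' : Finset (Orb (Fin 2 ×ₗ FermionTorus 2 2)),
                ((fermionEmbed inlCell (u ℓ.1) * fermionEmbed inrCell (u (shiftCell ℓ.1 ℓ.2)))ᴴ *
                    hamiltonian (linkGraph ℓ.2) t 0 *
                  (fermionEmbed inlCell (u ℓ.1) * fermionEmbed inrCell (u (shiftCell ℓ.1 ℓ.2)))) s s' *
                slaterRDM ((spinBlock fun σ => blochMatrix hkM fun κ => bernoulliProj (hQh σ κ) (E (σ, κ))).submatrix
                  (fun a => orb (linkEmb hm ℓ.1 ℓ.2 (ofLex a).1) (ofLex a).2)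
                  (fun a => orb (linkEmb hm ℓ.1 ℓ.2 (ofLex a).1) (ofLex a).2)) s s').re) / ((m * 2 : ℕ) : ℝ) ^ 2 +
        16 * |t| / ((m * 2 : ℕ) : ℝ) := by
  have hL : 3 ≤ m * 2 := by omega
  have hLe : Even (m * 2) := ⟨m, by ring⟩
  haveI : NeZero (m * 2) := ⟨by omega⟩
  refine energyDensity2D_le_avg_of_slaterBound hkM hL hLe t hU Q hQh h0 h1 hn0 hn2
    (fun P : Matrix (Orb (FermionTorus 2 (m * 2))) (Orb (FermionTorus 2 (m * 2))) ℂ =>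
      ((∑ c : Fin 2 → Fin m, ∑ s : Finset (Orb (FermionTorus 2 2)), ∑ s' : Finset (Orb (FermionTorus 2 2)),
          ((u c)ᴴ * hamiltonian plaquetteGraph t U * u c) s s' *
            slaterRDM (P.submatrix (fun a => orb (cellEmb c (ofLex a).1) (ofLex a).2)
              (fun a => orb (cellEmb c (ofLex a).1) (ofLex a).2)) s s') +
        ∑ ℓ : (Fin 2 → Fin m) × Fin 2, ∑ s : Finset (Orb (Fin 2 ×ₗ FermionTorus 2 2)),
          ∑ s' : Finset (Orb (Fin 2 ×ₗ FermionTorus 2 2)),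
            ((fermionEmbed inlCell (u ℓ.1) * fermionEmbed inrCell (u (shiftCell ℓ.1 ℓ.2)))ᴴ *
                hamiltonian (linkGraph ℓ.2) t 0 *
              (fermionEmbed inlCell (u ℓ.1) * fermionEmbed inrCell (u (shiftCell ℓ.1 ℓ.2)))) s s' *
            slaterRDM (P.submatrix (fun a => orb (linkEmb hm ℓ.1 ℓ.2 (ofLex a).1) (ofLex a).2)
              (fun a => orb (linkEmb hm ℓ.1 ℓ.2 (ofLex a).1) (ofLex a).2)) s s').re)
    fun P hP hPP N htr => ?_
  exact groundEnergyAt_le_dressed hm t U hP hPP htr u hu huN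

end Dressed

end Summit.Ventures.CertifiedManyBodySolver.Upper
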